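import Summits.HodgeConjecture.CorCM.TwoGroupCaseAReduceLemmas
import HarnessLib

/-!
# Case A of the order-`32` base: reduction of family CA2 with `θ̄ ≠ id` to the four free bits of CA2-Swap

COR-CM (cell `pub-hodgecm2`), binder seat b04 (gen 37), count-neutral own lane «Galois-CM-type classification».  KERNEL ONLY:
theorems; no definition, no named fact, no `sorry`.  Pure group theory (A7-JUNCTION gen-37 addendum).  Raw relations in a
basis `a, b = x a x⁻¹` of `C(t)/N`: `a² = t^{α₁}c^{α₂}`, `ba = ab t^{γ₁}c^{γ₂}`, `x b x⁻¹ = t^{p₂}c^{q₂}a^{e₃}b^{e₄}`,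
`x² = t^{p₃}c^{q₃}a^{e₅}b^{e₆}`.  Since `θ = conj(x)` is an automorphism with `θ² = conj(x²)` and `θ(x²) = x²`:
`(e₃, e₄) = (1, 0)`, `γ₁ = 0`, `p₂ = 0`, `q₂ = γ₂e₆`, `e₅ = e₆ = ε`, `p₃ = 0`, and `b² = t^{α₁}c^{α₁+α₂}`; after `x ↦ x t^{q₃}`
the relations become those of `exists_simple_degenerate_of_ca2_swap` (`swap_reduce`).

## References

* [Rotman1995] J. J. Rotman, *An Introduction to the Theory of Groups*, 4th ed., GTM 148, Ch. 5 and Ch. 7 (extensions).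
-/

namespace Summit.HodgeConjecture.CorCM.GaloisModels.CaseA

open Summit.HodgeConjecture.CorCM.GaloisTableLaws (zmod2_cases)

variable {G : Type*} [Group G]

/-! ## §1 Bit powers -/

/-- `(tᵖ c^q)^{e} = t^{pe} c^{qe}` on bits (commuting involutions). [folklore] -/
theorem invol_word_pow_bit {t c : G} (p q e : ZMod 2) :
    (t ^ p.val * c ^ q.val) ^ e.val = t ^ (p * e).val * c ^ (q * e).val := by
  rcases zmod2_cases e with rfl | rfl
  · rw [ZMod.val_zero, pow_zero, mul_zero, mul_zero, ZMod.val_zero, pow_zero, pow_zero, mul_one]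
  · rw [show (1 : ZMod 2).val = 1 from rfl, pow_one, mul_one, mul_one]

/-- From `b a b⁻¹ = a n` (`n` commuting with `b`): `b^{e} a b^{-e} = a n^{e}` on bits. [folklore] -/
theorem conj_pow_bit {a b n : G} (h : b * a * b⁻¹ = a * n) (e : ZMod 2) :
    b ^ e.val * a * (b ^ e.val)⁻¹ = a * n ^ e.val := by
  rcases zmod2_cases e with rfl | rfl
  · rw [ZMod.val_zero, pow_zero, pow_zero, mul_one]; group
  · rw [show (1 : ZMod 2).val = 1 from rfl, pow_one, pow_one]; exact h

/-- From `b a = a b n`: `b^{e} a^{f} = a^{f} b^{e} n^{ef}` on bits. [folklore] -/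
theorem pow_bit_swap {a b n : G} (hba : b * a = a * b * n) (e f : ZMod 2) :
    b ^ e.val * a ^ f.val = a ^ f.val * b ^ e.val * n ^ (e * f).val := by
  have hv1 : (1 : ZMod 2).val = 1 := rfl
  rcases zmod2_cases e with rfl | rfl <;> rcases zmod2_cases f with rfl | rfl <;>
    simp only [ZMod.val_zero, hv1, pow_zero, pow_one, one_mul, mul_one, mul_zero]
  exact hba

/-! ## §2 The reduction -/

/-- **Reduction to CA2-Swap.**  See the module docstring. [cite: Rotman1995, Ch. 5 and Ch. 7] -/
theorem swap_reduce {t c x a b : G} (hcc : c * c = 1) (hc1 : c ≠ 1) (hcen : ∀ g : G, c * g = g * c) (htt : t * t = 1)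
    (ht1 : t ≠ 1) (htne : t ≠ c) (hxt : x * t * x⁻¹ = t * c) (hat : a * t = t * a) (hbt : b * t = t * b)
    (ha : ∀ p q : ZMod 2, a ≠ t ^ p.val * c ^ q.val) (hb : ∀ p q i : ZMod 2, b ≠ t ^ p.val * (c ^ q.val * a ^ i.val))
    {α₁ α₂ γ₁ γ₂ p₂ q₂ e₃ e₄ p₃ q₃ e₅ e₆ : ZMod 2}
    (haa : a * a = t ^ α₁.val * c ^ α₂.val) (hba : b * a = a * b * (t ^ γ₁.val * c ^ γ₂.val))
    (hxa : x * a = b * x) (hxb : x * b = t ^ p₂.val * c ^ q₂.val * a ^ e₃.val * b ^ e₄.val * x)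
    (hxx : x * x = t ^ p₃.val * c ^ q₃.val * a ^ e₅.val * b ^ e₆.val) :
    ∃ x' : G, x' * t * x'⁻¹ = t * c ∧ b * b = t ^ α₁.val * c ^ (α₁ + α₂).val ∧ b * a = a * b * c ^ γ₂.val ∧
      x' * a = b * x' ∧ x' * b = c ^ (γ₂ * e₅).val * a * x' ∧ x' * x' = a ^ e₅.val * b ^ e₅.val := by
  have hv1 : (1 : ZMod 2).val = 1 := rfl
  have htc : t * c = c * t := (hcen t).symm
  have hxa' : x * a * x⁻¹ = b := by rw [hxa]; group
  have hxb' : x * b * x⁻¹ = t ^ p₂.val * c ^ q₂.val * a ^ e₃.val * b ^ e₄.val := by rw [hxb]; group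
  -- words in `t, c` commute with `a`, `b`
  have hwa : ∀ p q : ZMod 2, t ^ p.val * c ^ q.val * a = a * (t ^ p.val * c ^ q.val) := fun p q =>
    (((show Commute t a from hat.symm).pow_left _).mul_left ((show Commute c a from hcen a).pow_left _)).eq
  have hwb : ∀ p q : ZMod 2, t ^ p.val * c ^ q.val * b = b * (t ^ p.val * c ^ q.val) := fun p q =>
    (((show Commute t b from hbt.symm).pow_left _).mul_left ((show Commute c b from hcen b).pow_left _)).eq
  have hinj := words_injective_pair htt hcc htc ht1 htne hc1 hat (hcen a).symm haa ha hb
  -- `b² = θ(a²)`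
  have hbb : b * b = t ^ α₁.val * c ^ (α₁ + α₂).val := by
    rw [← hxa', show x * a * x⁻¹ * (x * a * x⁻¹) = x * (a * a) * x⁻¹ by group, haa, conj_tc_word hcc hcen htc hxt]
  -- `b a b⁻¹ = a n`, `n = t^{γ₁} c^{γ₂}`
  have hbab : b * a * b⁻¹ = a * (t ^ γ₁.val * c ^ γ₂.val) := by
    rw [hba, show a * b * (t ^ γ₁.val * c ^ γ₂.val) * b⁻¹ = a * (b * (t ^ γ₁.val * c ^ γ₂.val)) * b⁻¹ by group, ← hwb]
    group
  -- words in `t, c` commute with each other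
  have hww : ∀ p q p' q' : ZMod 2, t ^ p.val * c ^ q.val * (t ^ p'.val * c ^ q'.val) =
      t ^ p'.val * c ^ q'.val * (t ^ p.val * c ^ q.val) := fun p q p' q' => by
    rw [invol_word_mul htt hcc htc, invol_word_mul htt hcc htc, add_comm p, add_comm q]
  -- (S1) `θ(b) = (x²) a (x²)⁻¹ = t^{γ₁ e₆} c^{γ₂ e₆} a`
  have hθb : x * b * x⁻¹ = t ^ (γ₁ * e₆).val * c ^ (γ₂ * e₆).val * a := by
    have h1 : x * b * x⁻¹ = (x * x) * a * (x * x)⁻¹ := by rw [← hxa']; group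
    have h2 : (x * x) * a * (x * x)⁻¹ = (t ^ p₃.val * c ^ q₃.val) *
        (a ^ e₅.val * (b ^ e₆.val * a * (b ^ e₆.val)⁻¹) * (a ^ e₅.val)⁻¹) * (t ^ p₃.val * c ^ q₃.val)⁻¹ := by
      rw [hxx]; group
    have h3 : b ^ e₆.val * a * (b ^ e₆.val)⁻¹ = a * (t ^ (γ₁ * e₆).val * c ^ (γ₂ * e₆).val) := by
      rw [conj_pow_bit hbab, invol_word_pow_bit]
    have hNa : Commute (t ^ (γ₁ * e₆).val * c ^ (γ₂ * e₆).val) a := hwa _ _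
    have hWa : Commute (t ^ p₃.val * c ^ q₃.val) a := hwa _ _
    have hWN : Commute (t ^ p₃.val * c ^ q₃.val) (t ^ (γ₁ * e₆).val * c ^ (γ₂ * e₆).val) := hww _ _ _ _
    have h4 : a ^ e₅.val * (a * (t ^ (γ₁ * e₆).val * c ^ (γ₂ * e₆).val)) * (a ^ e₅.val)⁻¹ =
        a * (t ^ (γ₁ * e₆).val * c ^ (γ₂ * e₆).val) := by
      have hc : Commute (a ^ e₅.val) (a * (t ^ (γ₁ * e₆).val * c ^ (γ₂ * e₆).val)) :=
        ((Commute.refl a).pow_left _).mul_right (hNa.symm.pow_left _)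
      rw [hc.eq]; group
    have h5 : (t ^ p₃.val * c ^ q₃.val) * (a * (t ^ (γ₁ * e₆).val * c ^ (γ₂ * e₆).val)) * (t ^ p₃.val * c ^ q₃.val)⁻¹ =
        a * (t ^ (γ₁ * e₆).val * c ^ (γ₂ * e₆).val) := by
      rw [(hWa.mul_right hWN).eq]; group
    rw [h1, h2, h3, h4, h5, hNa.eq]
  have hS1 : e₃ = 1 ∧ e₄ = 0 ∧ p₂ = γ₁ * e₆ ∧ q₂ = γ₂ * e₆ := by
    have h := hxb'.symm.trans hθb
    have h2 : (fun P : ZMod 2 × ZMod 2 × ZMod 2 × ZMod 2 => t ^ P.1.val * c ^ P.2.1.val * a ^ P.2.2.1.val * b ^ P.2.2.2.val)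
        (p₂, q₂, e₃, e₄) = (fun P : ZMod 2 × ZMod 2 × ZMod 2 × ZMod 2 =>
        t ^ P.1.val * c ^ P.2.1.val * a ^ P.2.2.1.val * b ^ P.2.2.2.val) (γ₁ * e₆, γ₂ * e₆, 1, 0) := by
      simp only [hv1, ZMod.val_zero, pow_one, pow_zero, mul_one]; exact h
    have h3 := hinj h2
    simp only [Prod.mk.injEq] at h3
    exact ⟨h3.2.2.1, h3.2.2.2, h3.1, h3.2.1⟩
  obtain ⟨rfl, rfl, rfl, rfl⟩ := hS1
  -- (S3) `γ₁ = 0`: conjugate `b a = a b n` by `x`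
  have hγ : γ₁ = 0 := by
    have h1 : x * (b * a) * x⁻¹ = (x * b * x⁻¹) * (x * a * x⁻¹) := by group
    rw [hba, show x * (a * b * (t ^ γ₁.val * c ^ γ₂.val)) * x⁻¹ = (x * a * x⁻¹) * (x * b * x⁻¹) *
      (x * (t ^ γ₁.val * c ^ γ₂.val) * x⁻¹) by group, conj_tc_word hcc hcen htc hxt, hxa', hθb] at h1
    -- `b (n' a) w = n' a b`, i.e. `n' ((a b n) w) = n' (a b)`
    rw [show b * (t ^ (γ₁ * e₆).val * c ^ (γ₂ * e₆).val * a) = t ^ (γ₁ * e₆).val * c ^ (γ₂ * e₆).val * (b * a) by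
      rw [← mul_assoc, ← hwb]; group, hba, mul_assoc (t ^ (γ₁ * e₆).val * c ^ (γ₂ * e₆).val) a b,
      mul_assoc (t ^ (γ₁ * e₆).val * c ^ (γ₂ * e₆).val)] at h1
    have h2 := mul_left_cancel h1
    rw [mul_assoc (a * b)] at h2
    have h3 : t ^ γ₁.val * c ^ γ₂.val * (t ^ γ₁.val * c ^ (γ₁ + γ₂).val) = 1 :=
      mul_left_cancel (h2.trans (mul_one (a * b)).symm)
    rw [invol_word_mul htt hcc htc] at h3
    have h4 := (invol_word_eq_one hcc ht1 htne hc1 h3).2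
    have h5 : ∀ z w : ZMod 2, w + (z + w) = 0 → z = 0 := by decide
    exact h5 _ _ h4
  subst hγ
  simp only [zero_mul, ZMod.val_zero, pow_zero, one_mul] at hba hbab hθb hxb hxb'
  -- (S6) `θ(x²) = x²`: `e₅ = e₆`, `p₃ = 0`
  have hS6 : e₅ = e₆ ∧ p₃ = 0 := by
    have h1 : x * (x * x) * x⁻¹ = (x * (t ^ p₃.val * c ^ q₃.val) * x⁻¹) * (x * a * x⁻¹) ^ e₅.val *
        (x * b * x⁻¹) ^ e₆.val := by rw [hxx, conj_pow, conj_pow]; group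
    rw [show x * (x * x) * x⁻¹ = x * x by group, conj_tc_word hcc hcen htc hxt, hxa', hθb,
      ((show Commute c a from hcen a).pow_left _).mul_pow, ← pow_mul] at h1
    -- `h1 : x² = t^{p₃} c^{p₃+q₃} * b^{e₅} * (c^{m} * a^{e₆})`; normalise the right side
    have h2 : b ^ e₅.val * (c ^ ((γ₂ * e₆).val * e₆.val) * a ^ e₆.val) =
        c ^ ((γ₂ * e₆).val * e₆.val) * (a ^ e₆.val * b ^ e₅.val * (c ^ γ₂.val) ^ (e₅ * e₆).val) := by
      rw [← mul_assoc, ((show Commute c b from hcen b).pow_pow _ _).symm.eq, mul_assoc, pow_bit_swap hba]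
    have h3 : t ^ p₃.val * c ^ (p₃ + q₃).val * b ^ e₅.val * (c ^ ((γ₂ * e₆).val * e₆.val) * a ^ e₆.val) =
        t ^ p₃.val * (c ^ (p₃ + q₃).val * c ^ ((γ₂ * e₆).val * e₆.val) * c ^ (γ₂.val * (e₅ * e₆).val)) *
        a ^ e₆.val * b ^ e₅.val := by
      rw [mul_assoc (t ^ p₃.val * c ^ (p₃ + q₃).val), h2, ← pow_mul,
        ← (((show Commute c a from hcen a).pow_pow _ _).mul_right ((show Commute c b from hcen b).pow_pow _ _)).eq]
      group
    have hvm : ∀ z w : ZMod 2, c ^ (z * w).val = c ^ (z.val * w.val) := fun z w =>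
      GaloisTableLaws.pow_eq_pow_of_mod_eq c (n := 2) (by rw [pow_two, hcc]) (by rw [ZMod.val_mul]; omega)
    have hcw : c ^ (p₃ + q₃).val * c ^ ((γ₂ * e₆).val * e₆.val) * c ^ (γ₂.val * (e₅ * e₆).val) =
        c ^ (p₃ + q₃ + γ₂ * e₆ * e₆ + γ₂ * (e₅ * e₆)).val := by
      rw [FrattiniTwo.invol_pow_add hcc (p₃ + q₃ + γ₂ * e₆ * e₆), FrattiniTwo.invol_pow_add hcc (p₃ + q₃),
        hvm (γ₂ * e₆) e₆, hvm γ₂ (e₅ * e₆)]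
    rw [h3, hcw] at h1
    have h4 : (fun P : ZMod 2 × ZMod 2 × ZMod 2 × ZMod 2 => t ^ P.1.val * c ^ P.2.1.val * a ^ P.2.2.1.val * b ^ P.2.2.2.val)
        (p₃, q₃, e₅, e₆) = (fun P : ZMod 2 × ZMod 2 × ZMod 2 × ZMod 2 =>
        t ^ P.1.val * c ^ P.2.1.val * a ^ P.2.2.1.val * b ^ P.2.2.2.val) (p₃, p₃ + q₃ + γ₂ * e₆ * e₆ + γ₂ * (e₅ * e₆), e₆, e₅) := by
      simp only []
      rw [← hxx]; exact h1
    have h5 := hinj h4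
    simp only [Prod.mk.injEq] at h5
    obtain ⟨-, hq, h56, -⟩ := h5
    refine ⟨h56, ?_⟩
    rw [← h56] at hq
    have h6 : ∀ z w v e : ZMod 2, w = z + w + v * e * e + v * (e * e) → z = 0 := by decide
    exact h6 _ _ _ _ hq
  obtain ⟨h56, hp3⟩ := hS6
  subst hp3
  rw [← h56] at hxx hθb
  rw [ZMod.val_zero, pow_zero, one_mul] at hxx
  -- the new `x' = x t^{q₃}`
  refine ⟨x * t ^ q₃.val, ?_, hbb, hba, ?_, ?_, ?_⟩
  · rw [conj_mul_tpow (rfl : t * t = t * t) q₃, hxt]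
  · have hc : Commute (t ^ q₃.val) a := (show Commute t a from hat.symm).pow_left _
    rw [mul_assoc, hc.eq, ← mul_assoc, hxa, mul_assoc]
  · have h : x * b = c ^ (γ₂ * e₅).val * a * x := by rw [← hθb]; group
    have hc : Commute (t ^ q₃.val) b := (show Commute t b from hbt.symm).pow_left _
    have hc' : Commute (t ^ q₃.val) (c ^ (γ₂ * e₅).val * a) :=
      ((show Commute t c from htc).pow_pow _ _).mul_right ((show Commute t a from hat.symm).pow_left _)
    calc x * t ^ q₃.val * b = x * (t ^ q₃.val * b) := mul_assoc _ _ _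
      _ = x * (b * t ^ q₃.val) := by rw [hc.eq]
      _ = (x * b) * t ^ q₃.val := (mul_assoc _ _ _).symm
      _ = c ^ (γ₂ * e₅).val * a * x * t ^ q₃.val := by rw [h]
      _ = c ^ (γ₂ * e₅).val * a * (x * t ^ q₃.val) := mul_assoc _ _ _
  · rw [xsq_mul_tpow hcc hcen htt hxt, hxx]
    calc c ^ q₃.val * a ^ e₅.val * b ^ e₅.val * c ^ q₃.val = c ^ q₃.val * (a ^ e₅.val * b ^ e₅.val * c ^ q₃.val) := by group
      _ = c ^ q₃.val * (c ^ q₃.val * (a ^ e₅.val * b ^ e₅.val)) := by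
          rw [(((show Commute c a from hcen a).pow_pow _ _).mul_right ((show Commute c b from hcen b).pow_pow _ _)).eq.symm]
      _ = (c ^ q₃.val * c ^ q₃.val) * (a ^ e₅.val * b ^ e₅.val) := by group
      _ = a ^ e₅.val * b ^ e₅.val := by
          rw [← FrattiniTwo.invol_pow_add hcc, show (q₃ + q₃).val = 0 by rcases zmod2_cases q₃ with rfl | rfl <;> rfl,
            pow_zero, one_mul]

end Summit.HodgeConjecture.CorCM.GaloisModels.CaseA
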